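import Literature.Analysis.Complex.PlaneDomainKoebeTowerStep
import Mathlib.Analysis.Complex.Schwarz
import Mathlib.Topology.Order.MonotoneConvergence
import Mathlib.Analysis.SpecialFunctions.Sqrt
import HarnessLib

/-!
# Uniformization of plane domains, brick N1c (ii): the Koebe–Fisher–Hubbard–Wittner tower and its limits

PROOF-ONLY file (no definitions; abc-iut cell, seat abc-iut-w5-d038 gen 6, brick «UNIF-G1P · N1c-TOWER»
of abc-iut-L4-t8's programme behind the named fact `Complex.PlaneDomainDiscCovering`, GAP row
G-L4t8g7-1).  Y. Fisher, J. H. Hubbard, B. S. Wittner, *A proof of the uniformization theorem for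
arbitrary plane domains*, Proc. AMS **104** (1988) 413–418, §3 Parts b–c: iterating the square-root step
(`PlaneDomainKoebeTowerStep.lean`) from `V₀ = U ⊆ 𝔻`, `P₀ = id`, `G₀ = F` yields holomorphic self-maps
`P_n = B₁ ∘ ⋯ ∘ B_n` and `G_n` of the disc fixing `0` with `P_n ∘ G_n = F`, the based holomorphic lifting
property of `P_n` over `U`, and real numbers `d_n = P_n′(0) > 0`, `r_n ≤ 1` with `ball 0 r_n ⊆ V_n`,
`d_{n+1} ≤ d_n`, `(1 - r_n)²/8 ≤ 1 - d_{n+1}/d_n`.  When `F` is EXTREMAL (FHW p. 413: `‖F′(0)‖` maximal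
among holomorphic `f : 𝔻 → U` with `f 0 = 0`; brick N1b `Complex.exists_norm_deriv_max_of_locallyBounded`)
two one-line estimates drive the convergence, replacing FHW's Lemma 3.3.1 and their universal covering
`Ũ`: (i) the Schwarz lemma for `G_n` in `F′(0) = P_n′(0)·G_n′(0)` gives `d_n ≥ ‖F′(0)‖ > 0`, so `d_n`
converges to a positive limit, `d_{n+1}/d_n → 1` and hence `r_n → 1` («`|a_n| → 1`», FHW p. 417);
(ii) the TEST MAP `z ↦ P_n(r_n z)` belongs to the family, so `r_n d_n ≤ ‖F′(0)‖ = d_n ‖G_n′(0)‖`, i.e.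
`r_n ≤ ‖G_n′(0)‖ ≤ 1`.  Hence:

* **`Complex.exists_koebeTower_of_extremal`** — for `U ⊆ 𝔻` open with `0 ∈ U` and `F` extremal there are
  sequences `P_n, G_n` of holomorphic self-maps of `𝔻` fixing `0` with `P_n ∘ G_n = F` on `𝔻`, the based
  holomorphic lifting property «every holomorphic `g : 𝔻 → U` with `g 0 = F z` lifts through `P_n` to a
  holomorphic `ĝ : 𝔻 → 𝔻` with `ĝ 0 = G_n z`», and **`‖G_n′(0)‖ → 1`**.

The disc-lifting property of `F` itself (Montel + the equality case of the Schwarz lemma) follows in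
`PlaneDomainExtremalDiscLift.lean`.  Classical mathematics; nothing here touches [IUTchIII] Cor. 3.12.
[cite: FisherHubbardWittner1988, §3 Parts b–c pp.415–417]
-/

noncomputable section

open Set Metric Filter Topology Function

namespace Complex

/-- **The Koebe–Fisher–Hubbard–Wittner tower of an extremal map** (FHW 1988 §3 Parts b–c, with the
disc in place of the universal covering `Ũ`).  Let `U ⊆ 𝔻` be open with `0 ∈ U` and let `F` be
holomorphic on `𝔻` with `F(𝔻) ⊆ U`, `F 0 = 0` and `‖F′(0)‖` maximal among such maps.  Then there are
holomorphic self-maps `P n`, `G n` of `𝔻` fixing `0` (`P n = B₁ ∘ ⋯ ∘ B_n` the composite of `n`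
square-root steps, `G n` the lift of `F`) with `P n ∘ G n = F` on `𝔻`; every holomorphic `g : 𝔻 → U`
with `g 0 = F z` lifts through `P n` to a holomorphic `ĝ : 𝔻 → 𝔻` with `ĝ 0 = G n z`; and
`‖(G n)′(0)‖ → 1` («`|a_n| → 1`», p. 417, by the Schwarz lemma and the test maps `z ↦ P n (r_n z)`).
[cite: FisherHubbardWittner1988, §3 Parts b–c pp.415–417] -/
theorem exists_koebeTower_of_extremal {U : Set ℂ} (hUo : IsOpen U) (hU : U ⊆ ball (0 : ℂ) 1)
    (h0 : (0 : ℂ) ∈ U) {F : ℂ → ℂ} (hF : DifferentiableOn ℂ F (ball 0 1))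
    (hFU : MapsTo F (ball 0 1) U) (hF0 : F 0 = 0)
    (hmax : ∀ g : ℂ → ℂ, DifferentiableOn ℂ g (ball 0 1) → MapsTo g (ball 0 1) U → g 0 = 0 →
      ‖deriv g 0‖ ≤ ‖deriv F 0‖) :
    ∃ P G : ℕ → ℂ → ℂ,
      (∀ n, DifferentiableOn ℂ (P n) (ball 0 1)) ∧ (∀ n, MapsTo (P n) (ball 0 1) (ball 0 1)) ∧
      (∀ n, P n 0 = 0) ∧
      (∀ n, DifferentiableOn ℂ (G n) (ball 0 1)) ∧ (∀ n, MapsTo (G n) (ball 0 1) (ball 0 1)) ∧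
      (∀ n, G n 0 = 0) ∧ (∀ n, ∀ z ∈ ball (0 : ℂ) 1, P n (G n z) = F z) ∧
      (∀ n (g : ℂ → ℂ), DifferentiableOn ℂ g (ball 0 1) → MapsTo g (ball 0 1) U →
        ∀ z ∈ ball (0 : ℂ) 1, F z = g 0 → ∃ gl : ℂ → ℂ, DifferentiableOn ℂ gl (ball 0 1) ∧
          MapsTo gl (ball 0 1) (ball 0 1) ∧ gl 0 = G n z ∧ ∀ ζ ∈ ball (0 : ℂ) 1, P n (gl ζ) = g ζ) ∧
      Tendsto (fun n => ‖deriv (G n) 0‖) atTop (𝓝 1) := by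
  classical
  -- the invariant of a stage `s = (V, P, G, d)`
  let Inv : Set ℂ × (ℂ → ℂ) × (ℂ → ℂ) × ℝ → Prop := fun s =>
    IsOpen s.1 ∧ s.1 ⊆ ball (0 : ℂ) 1 ∧ (0 : ℂ) ∈ s.1 ∧
    DifferentiableOn ℂ s.2.1 (ball 0 1) ∧ MapsTo s.2.1 (ball 0 1) (ball 0 1) ∧
    MapsTo s.2.1 s.1 U ∧ s.2.1 0 = 0 ∧ deriv s.2.1 0 = (s.2.2.2 : ℂ) ∧ 0 < s.2.2.2 ∧
    DifferentiableOn ℂ s.2.2.1 (ball 0 1) ∧ MapsTo s.2.2.1 (ball 0 1) s.1 ∧ s.2.2.1 0 = 0 ∧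
    (∀ z ∈ ball (0 : ℂ) 1, s.2.1 (s.2.2.1 z) = F z) ∧
    (∀ g : ℂ → ℂ, DifferentiableOn ℂ g (ball 0 1) → MapsTo g (ball 0 1) U →
      ∀ y ∈ s.1, s.2.1 y = g 0 → ∃ gl : ℂ → ℂ, DifferentiableOn ℂ gl (ball 0 1) ∧
        MapsTo gl (ball 0 1) s.1 ∧ gl 0 = y ∧ ∀ z ∈ ball (0 : ℂ) 1, s.2.1 (gl z) = g z)
  -- the initial stage `(U, id, F, 1)`
  have hinit : Inv (U, id, F, 1) := by
    refine ⟨hUo, hU, h0, differentiableOn_id, mapsTo_id _, mapsTo_id _, rfl, ?_, one_pos, hF, hFU,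
      hF0, fun z _ => rfl, fun g hg hgU y _ hy => ⟨g, hg, hgU, hy.symm, fun z _ => rfl⟩⟩
    simp
  -- the step
  have hstep : ∀ s : {s // Inv s}, ∃ s' : {s // Inv s}, s'.1.2.2.2 ≤ s.1.2.2.2 ∧
      ∃ r : ℝ, 0 ≤ r ∧ r ≤ 1 ∧ ball (0 : ℂ) r ⊆ s.1.1 ∧
        (1 - r) ^ 2 / 8 ≤ 1 - s'.1.2.2.2 / s.1.2.2.2 := by
    rintro ⟨⟨V, P, G, d⟩, hVo, hV, hV0, hP, hPm, hPV, hP0, hPd, hd, hG, hGm, hG0, hPG, hlift⟩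
    obtain ⟨V', P', G', d', hInv', hle, r, hr0, hr1, hball, hbound⟩ :=
      exists_koebeTowerStep hVo hV hV0 hP hPm hPV hP0 hPd hd hG hGm hG0 hPG hlift
    exact ⟨⟨(V', P', G', d'), hInv'⟩, hle, r, hr0, hr1, hball, hbound⟩
  choose step hle r hr0 hr1 hball hbound using hstep
  -- the sequence of stages and its components
  let seq : ℕ → {s // Inv s} := fun n => Nat.rec ⟨(U, id, F, 1), hinit⟩ (fun _ s => step s) n
  have seq_succ : ∀ n, seq (n + 1) = step (seq n) := fun n => rfl
  set P : ℕ → ℂ → ℂ := fun n => (seq n).1.2.1 with hPdef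
  set G : ℕ → ℂ → ℂ := fun n => (seq n).1.2.2.1 with hGdef
  set d : ℕ → ℝ := fun n => (seq n).1.2.2.2 with hddef
  set ρ : ℕ → ℝ := fun n => r (seq n) with hρdef
  have hI : ∀ n, Inv ((seq n).1.1, P n, G n, d n) := fun n => (seq n).2
  have hb0 : ball (0 : ℂ) 1 ∈ 𝓝 (0 : ℂ) := isOpen_ball.mem_nhds (mem_ball_self one_pos)
  -- stagewise facts
  have hPd : ∀ n, DifferentiableOn ℂ (P n) (ball 0 1) := fun n => (hI n).2.2.2.1
  have hPm : ∀ n, MapsTo (P n) (ball 0 1) (ball 0 1) := fun n => (hI n).2.2.2.2.1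
  have hPV : ∀ n, MapsTo (P n) (seq n).1.1 U := fun n => (hI n).2.2.2.2.2.1
  have hP0 : ∀ n, P n 0 = 0 := fun n => (hI n).2.2.2.2.2.2.1
  have hPder : ∀ n, deriv (P n) 0 = (d n : ℂ) := fun n => (hI n).2.2.2.2.2.2.2.1
  have hdpos : ∀ n, 0 < d n := fun n => (hI n).2.2.2.2.2.2.2.2.1
  have hGd : ∀ n, DifferentiableOn ℂ (G n) (ball 0 1) := fun n => (hI n).2.2.2.2.2.2.2.2.2.1
  have hGV : ∀ n, MapsTo (G n) (ball 0 1) (seq n).1.1 := fun n => (hI n).2.2.2.2.2.2.2.2.2.2.1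
  have hGm : ∀ n, MapsTo (G n) (ball 0 1) (ball 0 1) := fun n => (hGV n).mono_right (hI n).2.1
  have hG0 : ∀ n, G n 0 = 0 := fun n => (hI n).2.2.2.2.2.2.2.2.2.2.2.1
  have hPG : ∀ n, ∀ z ∈ ball (0 : ℂ) 1, P n (G n z) = F z :=
    fun n => (hI n).2.2.2.2.2.2.2.2.2.2.2.2.1
  have hlift : ∀ n (g : ℂ → ℂ), DifferentiableOn ℂ g (ball 0 1) → MapsTo g (ball 0 1) U →
      ∀ y ∈ (seq n).1.1, P n y = g 0 → ∃ gl : ℂ → ℂ, DifferentiableOn ℂ gl (ball 0 1) ∧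
        MapsTo gl (ball 0 1) (seq n).1.1 ∧ gl 0 = y ∧ ∀ z ∈ ball (0 : ℂ) 1, P n (gl z) = g z :=
    fun n => (hI n).2.2.2.2.2.2.2.2.2.2.2.2.2
  have hV0 : ∀ n, (0 : ℂ) ∈ (seq n).1.1 := fun n => (hI n).2.2.1
  -- the numerical facts of the recursion
  have hdsucc : ∀ n, d (n + 1) ≤ d n := fun n => hle (seq n)
  have hρ0 : ∀ n, 0 ≤ ρ n := fun n => hr0 (seq n)
  have hρ1 : ∀ n, ρ n ≤ 1 := fun n => hr1 (seq n)
  have hρball : ∀ n, ball (0 : ℂ) (ρ n) ⊆ (seq n).1.1 := fun n => hball (seq n)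
  have hρbound : ∀ n, (1 - ρ n) ^ 2 / 8 ≤ 1 - d (n + 1) / d n := fun n => hbound (seq n)
  -- (i) `‖F′(0)‖ = d n · ‖(G n)′(0)‖` and the Schwarz lemma for `G n`
  have hchain : ∀ n, ‖deriv F 0‖ = d n * ‖deriv (G n) 0‖ := by
    intro n
    have hev : F =ᶠ[𝓝 0] fun z => P n (G n z) := by
      filter_upwards [hb0] with z hz using (hPG n z hz).symm
    have h1 : DifferentiableAt ℂ (G n) 0 := (hGd n).differentiableAt hb0
    have h2 : DifferentiableAt ℂ (P n) (G n 0) := (hPd n).differentiableAt (by rw [hG0]; exact hb0)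
    rw [hev.deriv_eq, show (fun z => P n (G n z)) = P n ∘ G n from rfl, deriv_comp 0 h2 h1, hG0,
      hPder, norm_mul, Complex.norm_real, Real.norm_of_nonneg (hdpos n).le]
  have hSchwarz : ∀ n, ‖deriv (G n) 0‖ ≤ 1 := by
    intro n
    refine norm_deriv_le_one_of_mapsTo_ball (hGd n) ?_ one_pos
    rw [hG0]
    exact (hGm n).mono_right ball_subset_closedBall
  have hMle : ∀ n, ‖deriv F 0‖ ≤ d n := fun n => by
    rw [hchain n]
    exact mul_le_of_le_one_right (hdpos n).le (hSchwarz n)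
  -- `‖F′(0)‖ > 0`: the family contains `z ↦ ε z` for a small disc `ball 0 ε ⊆ U`
  have hMpos : 0 < ‖deriv F 0‖ := by
    obtain ⟨ε, hε, hεU⟩ := Metric.isOpen_iff.1 hUo 0 h0
    have hm : MapsTo (fun z : ℂ => (ε : ℂ) * z) (ball 0 1) U := by
      intro z hz
      apply hεU
      rw [mem_ball_zero_iff, norm_mul, Complex.norm_real, Real.norm_of_nonneg hε.le]
      have := mem_ball_zero_iff.1 hz
      nlinarith [norm_nonneg z]
    have h1 := hmax (fun z => (ε : ℂ) * z) (by fun_prop) hm (by simp)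
    have h2 : deriv (fun z : ℂ => (ε : ℂ) * z) 0 = ε := by
      simp
    rw [h2, Complex.norm_real, Real.norm_of_nonneg hε.le] at h1
    exact hε.trans_le h1
  -- (ii) the test maps `z ↦ P n (ρ n · z)` give `ρ n ≤ ‖(G n)′(0)‖`
  have htest : ∀ n, ρ n ≤ ‖deriv (G n) 0‖ := by
    intro n
    set g : ℂ → ℂ := fun z => P n ((ρ n : ℂ) * z) with hg
    have hin : ∀ z ∈ ball (0 : ℂ) 1, (ρ n : ℂ) * z ∈ (seq n).1.1 := by
      intro z hz
      rcases (hρ0 n).eq_or_lt with h | h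
      · rw [← h]; simpa using hV0 n
      · apply hρball n
        rw [mem_ball_zero_iff, norm_mul, Complex.norm_real, Real.norm_of_nonneg (hρ0 n)]
        have := mem_ball_zero_iff.1 hz
        nlinarith
    have hin1 : MapsTo (fun z : ℂ => (ρ n : ℂ) * z) (ball 0 1) (ball 0 1) :=
      fun z hz => (hI n).2.1 (hin z hz)
    have hgd : DifferentiableOn ℂ g (ball 0 1) := (hPd n).comp (by fun_prop) hin1
    have hgU : MapsTo g (ball 0 1) U := fun z hz => hPV n (hin z hz)
    have hg0 : g 0 = 0 := by simp [hg, hP0 n]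
    have hderiv : deriv g 0 = (d n : ℂ) * (ρ n : ℂ) := by
      have hPat : HasDerivAt (P n) (deriv (P n) 0) ((ρ n : ℂ) * 0) := by
        rw [mul_zero]
        exact ((hPd n).differentiableAt hb0).hasDerivAt
      have hlin : HasDerivAt (fun z : ℂ => (ρ n : ℂ) * z) (ρ n : ℂ) 0 := by
        simpa using (hasDerivAt_id (0 : ℂ)).const_mul (ρ n : ℂ)
      have := hPat.comp 0 hlin
      rw [hPder] at this
      exact this.deriv
    have h1 := hmax g hgd hgU hg0
    rw [hderiv, norm_mul, Complex.norm_real, Complex.norm_real, Real.norm_of_nonneg (hdpos n).le,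
      Real.norm_of_nonneg (hρ0 n), hchain n] at h1
    exact le_of_mul_le_mul_left h1 (hdpos n)
  -- `d n` converges to a positive limit, so `d (n+1) / d n → 1` and `ρ n → 1`
  have hd_anti : Antitone d := antitone_nat_of_succ_le hdsucc
  have hbdd : BddBelow (range d) := ⟨‖deriv F 0‖, by rintro _ ⟨n, rfl⟩; exact hMle n⟩
  have hdlim : Tendsto d atTop (𝓝 (⨅ n, d n)) := tendsto_atTop_ciInf hd_anti hbdd
  have hinf_pos : 0 < ⨅ n, d n := hMpos.trans_le (le_ciInf hMle)
  have hratio : Tendsto (fun n => d (n + 1) / d n) atTop (𝓝 1) := by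
    have := (hdlim.comp (tendsto_add_atTop_nat 1)).div hdlim hinf_pos.ne'
    rwa [div_self hinf_pos.ne'] at this
  have hsq : Tendsto (fun n => (1 - ρ n) ^ 2) atTop (𝓝 0) := by
    have h8 : Tendsto (fun n => 8 * (1 - d (n + 1) / d n)) atTop (𝓝 0) := by
      have := (tendsto_const_nhds (x := (1 : ℝ))).sub hratio
      simpa using this.const_mul 8
    refine squeeze_zero (fun n => sq_nonneg _) (fun n => ?_) h8
    have := hρbound n
    linarith
  have hρlim : Tendsto ρ atTop (𝓝 1) := by
    have h1 : Tendsto (fun n => Real.sqrt ((1 - ρ n) ^ 2)) atTop (𝓝 0) := by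
      simpa using hsq.sqrt
    have h2 : (fun n => Real.sqrt ((1 - ρ n) ^ 2)) = fun n => 1 - ρ n :=
      funext fun n => Real.sqrt_sq (by linarith [hρ1 n])
    rw [h2] at h1
    have := (tendsto_const_nhds (x := (1 : ℝ))).sub h1
    simpa using this
  -- conclusion
  refine ⟨P, G, hPd, hPm, hP0, hGd, hGm, hG0, hPG, fun n g hg hgU z hz hzg => ?_, ?_⟩
  · obtain ⟨gl, hgld, hglm, hgl0, hPgl⟩ := hlift n g hg hgU (G n z) (hGV n hz) (by rw [hPG n z hz, hzg])
    exact ⟨gl, hgld, hglm.mono_right (hI n).2.1, hgl0, hPgl⟩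
  · exact tendsto_of_tendsto_of_tendsto_of_le_of_le hρlim tendsto_const_nhds htest hSchwarz

end Complex

end
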